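import Mathlib
import Summits.Ventures.HodgeRepro.Tier4.Target
import Summits.Ventures.HodgeRepro.Tier4.Common.AutForms
import Summits.Ventures.HodgeRepro.Tier4.Line4.MixedTransfer
import Summits.Ventures.HodgeRepro.Tier4.Line4.Forms11
import Summits.Ventures.HodgeRepro.Tier4.Line4.HoloRegularity
import Summits.Ventures.HodgeRepro.Tier4.Line4.MixedClosed
import Summits.Ventures.HodgeRepro.Tier4.Line4.ExactOnBall

/-!
# Tier4/Line4/WirtingerChain — the Wirtinger operators under a holomorphic change of variables, and the naturality
of `(dη)^{1,1}` (SUPPORT for L4.0′ `pair11_descends`, V2)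

Blind re-derivation cell `pub-hodge-repro`, Tier 4 (README §9–§10), seat t4-L4-p2 (prover, LINE L4, gen 0).  Tree path
`lean/Summits/Ventures/HodgeRepro/Tier4/Line4/WirtingerChain.lean`.  Imports, BY NAME, `Line4/Forms11` (`dz`, `dzbar`),
`Line4/HoloRegularity` (the partials of a holomorphic map are holomorphic) and `Line4/ExactOnBall` (Leibniz `dz_mul`,
`dzbar_mul`).

WHAT IS PROVED.  (1) `dz_comp_holo` / `dzbar_comp_holo`, the CHAIN RULE for the Wirtinger operators under a map `g`
ℂ-differentiable at `z`: `∂_k (u ∘ g) = Σ_m ∂_k g_m · (∂_m u) ∘ g` and `∂̄_k (u ∘ g) = Σ_m conj (∂_k g_m) · (∂̄_m u) ∘ g`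
for `u` ℝ-differentiable at `g z` (the map `w ↦ ½ (T w − i T (i w))` is ℂ-linear in `w` for an ℝ-linear `T`).
(2) `dz_of_differentiableAt` (`∂_k h = pd k h`), `dzbar_of_differentiableAt` (`∂̄_k h = 0`), `dz_conj_of_differentiableAt`
(`∂_k (conj h) = 0`), `dzbar_conj_of_differentiableAt` (`∂̄_k (conj h) = conj (∂_k h)`) for `h` ℂ-differentiable at `z`.
(3) **`d11_pull1`, the naturality of the `(1,1)`-part of `d`**: for `g` holomorphic on an open set around `z` and a
`1`-form `η = Σ η¹_m dz_m + Σ η²_n dz̄_n` with ℝ-differentiable coefficients at `g z`, the `(1,1)`-part of `d` of the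
pulled-back form `g^*η` — coefficients `(g^*η)¹_k = Σ_m ∂_k g_m · η¹_m ∘ g`, `(g^*η)²_l = Σ_n conj (∂_l g_n) · η²_n ∘ g`
(the skeleton's `pull1`) — is the pull-back `Jᵀ · (dη)^{1,1} ∘ g · J̄` of the `(1,1)`-part of `dη`:
`∂_k (g^*η)²_l − ∂̄_l (g^*η)¹_k = Σ_{m,n} ∂_k g_m · (∂_m η²_n − ∂̄_n η¹_m) ∘ g · conj (∂_l g_n)`.
This is what makes the coboundaries `(dη)^{1,1}` of `Γ′`-invariant `1`-forms `Γ′`-invariant `(1,1)`-forms (L4.0′).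

Nothing here says anything about the status of the Hodge conjecture for CM abelian varieties, which is NOT proved
(HC_CM is NOT proved by anyone in this repository).
-/

set_option autoImplicit false

noncomputable section

open Matrix NumberField Topology
open scoped ComplexConjugate

namespace Summit.Ventures.HodgeRepro.Tier4.Line4

open Summit.Ventures.HodgeRepro.Tier4

/-! ## 1. The Wirtinger pairing of an ℝ-linear functional with a direction -/

/-- `a • w = re a • w + im a • (i • w)` in `ℂ²` (real scalars on the right). -/
theorem smul_eq_re_smul_add_im_smul (a : ℂ) (w : Fin 2 → ℂ) :
    a • w = (a.re : ℝ) • w + (a.im : ℝ) • (Complex.I • w) := by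
  funext i
  simp only [Pi.smul_apply, Pi.add_apply, smul_eq_mul, Complex.real_smul]
  apply Complex.ext
  · simp; ring
  · simp

/-- `(i a) • w = −im a • w + re a • (i • w)`. -/
theorem I_mul_smul_eq (a : ℂ) (w : Fin 2 → ℂ) :
    (Complex.I * a) • w = (-a.im : ℝ) • w + (a.re : ℝ) • (Complex.I • w) := by
  funext i
  simp only [Pi.smul_apply, Pi.add_apply, smul_eq_mul, Complex.real_smul]
  apply Complex.ext
  · simp; ring
  · simp

/-- `∂_w T := ½ (T w − i T (i w))` — ℂ-linear in `w` for an ℝ-linear `T : ℂ² → ℂ`. -/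
theorem wirt_smul (T : (Fin 2 → ℂ) →L[ℝ] ℂ) (a : ℂ) (w : Fin 2 → ℂ) :
    (1 / 2 : ℂ) * (T (a • w) - Complex.I * T (Complex.I • a • w)) =
      a * ((1 / 2 : ℂ) * (T w - Complex.I * T (Complex.I • w))) := by
  rw [smul_smul, I_mul_smul_eq, smul_eq_re_smul_add_im_smul]
  simp only [map_add, ContinuousLinearMap.map_smul, Complex.real_smul]
  apply Complex.ext <;> simp <;> ring

/-- `∂̄_w T := ½ (T w + i T (i w))` — conjugate-linear in `w`. -/
theorem wirtbar_smul (T : (Fin 2 → ℂ) →L[ℝ] ℂ) (a : ℂ) (w : Fin 2 → ℂ) :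
    (1 / 2 : ℂ) * (T (a • w) + Complex.I * T (Complex.I • a • w)) =
      conj a * ((1 / 2 : ℂ) * (T w + Complex.I * T (Complex.I • w))) := by
  rw [smul_smul, I_mul_smul_eq, smul_eq_re_smul_add_im_smul]
  simp only [map_add, ContinuousLinearMap.map_smul, Complex.real_smul]
  apply Complex.ext <;> simp <;> ring

/-- The Wirtinger pairing of a finite combination of directions. -/
theorem wirt_sum (T : (Fin 2 → ℂ) →L[ℝ] ℂ) (c : Fin 2 → ℂ) (e : Fin 2 → (Fin 2 → ℂ)) :
    (1 / 2 : ℂ) * (T (∑ m, c m • e m) - Complex.I * T (Complex.I • ∑ m, c m • e m)) =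
      ∑ m, c m * ((1 / 2 : ℂ) * (T (e m) - Complex.I * T (Complex.I • e m))) := by
  rw [Fin.sum_univ_two, Fin.sum_univ_two, smul_add, map_add, map_add, ← wirt_smul T (c 0) (e 0),
    ← wirt_smul T (c 1) (e 1)]
  ring

/-- The conjugate Wirtinger pairing of a finite combination of directions. -/
theorem wirtbar_sum (T : (Fin 2 → ℂ) →L[ℝ] ℂ) (c : Fin 2 → ℂ) (e : Fin 2 → (Fin 2 → ℂ)) :
    (1 / 2 : ℂ) * (T (∑ m, c m • e m) + Complex.I * T (Complex.I • ∑ m, c m • e m)) =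
      ∑ m, conj (c m) * ((1 / 2 : ℂ) * (T (e m) + Complex.I * T (Complex.I • e m))) := by
  rw [Fin.sum_univ_two, Fin.sum_univ_two, smul_add, map_add, map_add, ← wirtbar_smul T (c 0) (e 0),
    ← wirtbar_smul T (c 1) (e 1)]
  ring

/-! ## 2. The chain rule for the Wirtinger operators under a ℂ-differentiable map -/

/-- The `m`-th component of `fderiv ℂ g z (e_k)` is the partial `∂_k g_m`. -/
theorem fderiv_apply_single_eq_pd {g : (Fin 2 → ℂ) → (Fin 2 → ℂ)} {z : Fin 2 → ℂ} (hg : DifferentiableAt ℂ g z)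
    (k m : Fin 2) : fderiv ℂ g z (Pi.single k 1) m = pd k (fun w => g w m) z := by
  rw [fderiv_pi (differentiableAt_pi.mp hg)]
  rfl

/-- `fderiv ℂ g z (e_k) = Σ_m ∂_k g_m • e_m`. -/
theorem fderiv_apply_single_eq_sum {g : (Fin 2 → ℂ) → (Fin 2 → ℂ)} {z : Fin 2 → ℂ} (hg : DifferentiableAt ℂ g z)
    (k : Fin 2) :
    fderiv ℂ g z (Pi.single k 1) = ∑ m, pd k (fun w => g w m) z • (Pi.single m (1 : ℂ) : Fin 2 → ℂ) := by
  funext m'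
  rw [fderiv_apply_single_eq_pd hg]
  simp [Finset.sum_apply, Pi.single_apply]

/-- **Chain rule for `∂_k`** under a ℂ-differentiable map `g`: `∂_k (u ∘ g) z = Σ_m ∂_k g_m (z) · ∂_m u (g z)`. -/
theorem dz_comp {u : (Fin 2 → ℂ) → ℂ} {g : (Fin 2 → ℂ) → (Fin 2 → ℂ)} {z : Fin 2 → ℂ}
    (hu : DifferentiableAt ℝ u (g z)) (hg : DifferentiableAt ℂ g z) (k : Fin 2) :
    dz k (fun w => u (g w)) z = ∑ m, pd k (fun w => g w m) z * dz m u (g z) := by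
  have hcomp : fderiv ℝ (fun w => u (g w)) z =
      (fderiv ℝ u (g z)).comp ((fderiv ℂ g z).restrictScalars ℝ) :=
    (hu.hasFDerivAt.comp z (hg.hasFDerivAt.restrictScalars ℝ)).fderiv
  have hvI : fderiv ℂ g z (Pi.single k Complex.I) = Complex.I • fderiv ℂ g z (Pi.single k 1) := by
    rw [single_I_eq_smul, map_smul]
  unfold dz
  rw [hcomp]
  simp only [ContinuousLinearMap.comp_apply, ContinuousLinearMap.coe_restrictScalars']
  rw [hvI, fderiv_apply_single_eq_sum hg, wirt_sum]
  refine Finset.sum_congr rfl fun m _ => ?_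
  rw [single_I_eq_smul]

/-- **Chain rule for `∂̄_k`** under a ℂ-differentiable map `g`:
`∂̄_k (u ∘ g) z = Σ_m conj (∂_k g_m (z)) · ∂̄_m u (g z)`. -/
theorem dzbar_comp {u : (Fin 2 → ℂ) → ℂ} {g : (Fin 2 → ℂ) → (Fin 2 → ℂ)} {z : Fin 2 → ℂ}
    (hu : DifferentiableAt ℝ u (g z)) (hg : DifferentiableAt ℂ g z) (k : Fin 2) :
    dzbar k (fun w => u (g w)) z = ∑ m, conj (pd k (fun w => g w m) z) * dzbar m u (g z) := by
  have hcomp : fderiv ℝ (fun w => u (g w)) z =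
      (fderiv ℝ u (g z)).comp ((fderiv ℂ g z).restrictScalars ℝ) :=
    (hu.hasFDerivAt.comp z (hg.hasFDerivAt.restrictScalars ℝ)).fderiv
  have hvI : fderiv ℂ g z (Pi.single k Complex.I) = Complex.I • fderiv ℂ g z (Pi.single k 1) := by
    rw [single_I_eq_smul, map_smul]
  unfold dzbar
  rw [hcomp]
  simp only [ContinuousLinearMap.comp_apply, ContinuousLinearMap.coe_restrictScalars']
  rw [hvI, fderiv_apply_single_eq_sum hg, wirtbar_sum]
  refine Finset.sum_congr rfl fun m _ => ?_
  rw [single_I_eq_smul]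

/-! ## 3. The Wirtinger operators on holomorphic and anti-holomorphic functions -/

/-- `∂_k h = ∂h/∂z_k` for `h` ℂ-differentiable at `z`. -/
theorem dz_of_differentiableAt {h : (Fin 2 → ℂ) → ℂ} {z : Fin 2 → ℂ} (hh : DifferentiableAt ℂ h z) (k : Fin 2) :
    dz k h z = pd k h z := by
  unfold dz pd
  rw [(hh.hasFDerivAt.restrictScalars ℝ).fderiv]
  simp only [ContinuousLinearMap.coe_restrictScalars']
  rw [single_I_eq_smul, map_smul, smul_eq_mul]
  ring_nf
  simp [Complex.I_sq]
  ring

/-- `∂̄_k h = 0` for `h` ℂ-differentiable at `z`. -/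
theorem dzbar_of_differentiableAt {h : (Fin 2 → ℂ) → ℂ} {z : Fin 2 → ℂ} (hh : DifferentiableAt ℂ h z)
    (k : Fin 2) : dzbar k h z = 0 := by
  unfold dzbar
  rw [(hh.hasFDerivAt.restrictScalars ℝ).fderiv]
  simp only [ContinuousLinearMap.coe_restrictScalars']
  rw [single_I_eq_smul, map_smul, smul_eq_mul]
  ring_nf
  simp [Complex.I_sq]

/-- The real derivative of `conj ∘ h` for `h` ℂ-differentiable at `z`. -/
theorem fderiv_real_conj {h : (Fin 2 → ℂ) → ℂ} {z : Fin 2 → ℂ} (hh : DifferentiableAt ℂ h z) (v : Fin 2 → ℂ) :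
    fderiv ℝ (fun w => conj (h w)) z v = conj (fderiv ℂ h z v) := by
  have hh' : HasFDerivAt (fun w => conj (h w))
      ((Complex.conjCLE : ℂ →L[ℝ] ℂ).comp ((fderiv ℂ h z).restrictScalars ℝ)) z :=
    Complex.conjCLE.hasFDerivAt.comp z (hh.hasFDerivAt.restrictScalars ℝ)
  rw [hh'.fderiv]
  simp

/-- `∂_k (conj h) = 0` for `h` ℂ-differentiable at `z`. -/
theorem dz_conj_of_differentiableAt {h : (Fin 2 → ℂ) → ℂ} {z : Fin 2 → ℂ} (hh : DifferentiableAt ℂ h z)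
    (k : Fin 2) : dz k (fun w => conj (h w)) z = 0 := by
  unfold dz
  rw [fderiv_real_conj hh, fderiv_real_conj hh, single_I_eq_smul, map_smul, smul_eq_mul, map_mul, Complex.conj_I]
  ring_nf
  simp [Complex.I_sq]

/-- `∂̄_k (conj h) = conj (∂_k h)` for `h` ℂ-differentiable at `z`. -/
theorem dzbar_conj_of_differentiableAt {h : (Fin 2 → ℂ) → ℂ} {z : Fin 2 → ℂ} (hh : DifferentiableAt ℂ h z)
    (k : Fin 2) : dzbar k (fun w => conj (h w)) z = conj (pd k h z) := by
  unfold dzbar pd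
  rw [fderiv_real_conj hh, fderiv_real_conj hh, single_I_eq_smul, map_smul, smul_eq_mul, map_mul, Complex.conj_I]
  ring_nf
  simp [Complex.I_sq]
  ring

/-! ## 4. Linearity of the Wirtinger operators and the naturality of `(dη)^{1,1}` -/

/-- `∂_k` of a finite sum of ℝ-differentiable functions. -/
theorem dz_sum {F : Fin 2 → (Fin 2 → ℂ) → ℂ} {z : Fin 2 → ℂ} (hF : ∀ n, DifferentiableAt ℝ (F n) z) (k : Fin 2) :
    dz k (fun w => ∑ n, F n w) z = ∑ n, dz k (F n) z := by
  unfold dz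
  rw [fderiv_fun_sum fun n _ => hF n]
  simp only [FunLike.coe_sum, Finset.sum_apply, Finset.mul_sum]
  rw [← Finset.sum_sub_distrib, Finset.mul_sum]

/-- `∂̄_k` of a finite sum of ℝ-differentiable functions. -/
theorem dzbar_sum {F : Fin 2 → (Fin 2 → ℂ) → ℂ} {z : Fin 2 → ℂ} (hF : ∀ n, DifferentiableAt ℝ (F n) z)
    (k : Fin 2) : dzbar k (fun w => ∑ n, F n w) z = ∑ n, dzbar k (F n) z := by
  unfold dzbar
  rw [fderiv_fun_sum fun n _ => hF n]
  simp only [FunLike.coe_sum, Finset.sum_apply, Finset.mul_sum]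
  rw [← Finset.sum_add_distrib, Finset.mul_sum]

/-- **Naturality of the `(1,1)`-part of `d` under a holomorphic map** `g` (holomorphic on an open `U ∋ z`): for a
`1`-form with coefficients `η¹_m`, `η²_n` ℝ-differentiable at `g z`, the pulled-back coefficients
`(g^*η)¹_k = Σ_m ∂_k g_m · η¹_m ∘ g`, `(g^*η)²_l = Σ_n conj (∂_l g_n) · η²_n ∘ g` satisfy
`∂_k (g^*η)²_l − ∂̄_l (g^*η)¹_k = Σ_{m,n} ∂_k g_m · conj (∂_l g_n) · (∂_m η²_n − ∂̄_n η¹_m) ∘ g`,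
i.e. `(d (g^*η))^{1,1} = Jᵀ · (dη)^{1,1} ∘ g · J̄`. -/
theorem d11_pull1 {g : (Fin 2 → ℂ) → (Fin 2 → ℂ)} {U : Set (Fin 2 → ℂ)} (hU : IsOpen U)
    (hg : ∀ m, DifferentiableOn ℂ (fun w => g w m) U) {z : Fin 2 → ℂ} (hz : z ∈ U)
    {η₁ η₂ : (Fin 2 → ℂ) → (Fin 2 → ℂ)} (hη₁ : ∀ m, DifferentiableAt ℝ (fun w => η₁ w m) (g z))
    (hη₂ : ∀ n, DifferentiableAt ℝ (fun w => η₂ w n) (g z)) (k l : Fin 2) :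
    dz k (fun w => ∑ n, conj (pd l (fun w' => g w' n) w) * η₂ (g w) n) z
      - dzbar l (fun w => ∑ m, pd k (fun w' => g w' m) w * η₁ (g w) m) z
    = ∑ m, ∑ n, pd k (fun w' => g w' m) z * conj (pd l (fun w' => g w' n) z)
        * (dz m (fun w => η₂ w n) (g z) - dzbar n (fun w => η₁ w m) (g z)) := by
  have hgz : DifferentiableAt ℂ g z :=
    differentiableAt_pi.mpr fun m => (hg m).differentiableAt (hU.mem_nhds hz)
  have hpd : ∀ k m, DifferentiableAt ℂ (pd k (fun w => g w m)) z := fun k m =>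
    HoloReg.differentiableAt_pd hU (hg m) hz k
  have hgR : DifferentiableAt ℝ g z := hgz.restrictScalars ℝ
  have hη₁g : ∀ m, DifferentiableAt ℝ (fun w => η₁ (g w) m) z := fun m => (hη₁ m).comp z hgR
  have hη₂g : ∀ n, DifferentiableAt ℝ (fun w => η₂ (g w) n) z := fun n => (hη₂ n).comp z hgR
  have hconj : ∀ l n, DifferentiableAt ℝ (fun w => conj (pd l (fun w' => g w' n) w)) z := fun l n =>
    Complex.conjCLE.differentiableAt.comp z ((hpd l n).restrictScalars ℝ)
  -- expand the two sides
  rw [dz_sum (F := fun n w => conj (pd l (fun w' => g w' n) w) * η₂ (g w) n) (fun n => (hconj l n).mul (hη₂g n)),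
    dzbar_sum (F := fun m w => pd k (fun w' => g w' m) w * η₁ (g w) m)
      (fun m => ((hpd k m).restrictScalars ℝ).mul (hη₁g m))]
  have e2 : ∀ n, dz k (fun w => conj (pd l (fun w' => g w' n) w) * η₂ (g w) n) z =
      conj (pd l (fun w' => g w' n) z) * ∑ m, pd k (fun w' => g w' m) z * dz m (fun w => η₂ w n) (g z) := by
    intro n
    rw [dz_mul (hconj l n) (hη₂g n), dz_conj_of_differentiableAt (hpd l n), dz_comp (hη₂ n) hgz]
    ring
  have e1 : ∀ m, dzbar l (fun w => pd k (fun w' => g w' m) w * η₁ (g w) m) z =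
      pd k (fun w' => g w' m) z * ∑ n, conj (pd l (fun w' => g w' n) z) * dzbar n (fun w => η₁ w m) (g z) := by
    intro m
    rw [dzbar_mul ((hpd k m).restrictScalars ℝ) (hη₁g m), dzbar_of_differentiableAt (hpd k m), dzbar_comp (hη₁ m) hgz]
    ring
  simp only [e1, e2, Finset.mul_sum]
  rw [Finset.sum_comm (f := fun n m => conj (pd l (fun w' => g w' n) z) *
    (pd k (fun w' => g w' m) z * dz m (fun w => η₂ w n) (g z))), ← Finset.sum_sub_distrib]
  refine Finset.sum_congr rfl fun m _ => ?_
  rw [← Finset.sum_sub_distrib]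
  refine Finset.sum_congr rfl fun n _ => ?_
  ring

end Summit.Ventures.HodgeRepro.Tier4.Line4

end
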